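import Summits.Ventures.HSemireg.GeneralStructureWiring
import Summits.Ventures.HSemireg.AmplificationChainSigmaGluable
import Summits.HodgeConjecture.HodgeConjecture.Theorems.Ring2HypothesesGermDomination
import HarnessLib

/-!
# HSemireg venture · general structure (G4) — the WIRING in DOOR-AGNOSTIC form: uniform `𝒪`-admissible presentations at
# CM fibres ∧ the local variational Hodge statement FOR `𝒪` ⟹ `HC_AV`, modulo NAMED hypotheses; the PERFECT-COMPLEX door instantiated

HONEST FRAMING (speculative tier of cell `pub-hsemireg`, team «general structure», seat G4 = gs-g4; verbatim the cell's
wording rule): **nothing here says `HC`, `HC_AV` or `HC_CM` is proved; every implication carries its NAMED hypotheses,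
each a `Prop` with its citation.** This file is a Lean INDEX of implication chains. It asserts NOTHING about any explicit
variety, contains no `sorry`, no new axiom, no Literature fact, ONE new `@[conjecture] def` (a predicate in an object class
`𝒪`, OURS, never asserted) and uses only `propext`, `Classical.choice`, `Quot.sound`.

## Why this file (the one gap it closes)

Seat G4's wiring (`GeneralStructureWiring.lean`, 2026-08-22) typed «`HC_CM` ∧ [Deligne 1982 Prop. 6.1] ∧ [BF 2003 Thm. 5.1]
∧ `UniformSemiregularSheafLiftAtCM C` ⟹ `HC_AV`» for ONE door: finite locally free `I`-semiregular SHEAVES. Since then the cell's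
amplification chain was made DOOR-AGNOSTIC (seat p7, `AmplificationChainAssembly.lean`): an OBJECT CLASS is a predicate
`𝒪 : ObjClass`, and `LocalVariationalHodgeFor 𝒪` is the local variational Hodge statement FOR `𝒪` (the binders of the tree's
model rendering of BF Thm. 5.1 with the sheaf data replaced by `𝒪`-admissible classes). The door that PASSED the cell's STEP-0
at g = 4 (Markman's secant complex) is the PERFECT-COMPLEX door `perfectObjClass C gluableSigmaAdmissible` (bounded complexes of
vector bundles, `Ext^{<0} = 0`, `(σ_q)_{q+1∈I}` jointly injective), whose local variational statement is a TREE THEOREM modulo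
`PridhamPerfectLifts C` ([Pridham2024] Cor. 2.25, by name) and the Hodge-free algebraisation `PerfectComplexAlgebraisesLifts C`
(KERNEL from Lieblich-type versal charts, `perfectComplexAlgebraisesLifts_of_versalCharts`; EGA IV 17 discharged in the tree).
No file so far carried the perfect-complex door — or any door other than sheaves / Bloch lci — to the `HC_AV` end statement
(its door-agnostic consumers stop at Weil classes / components, HC on ONE `𝒜_g`-component (`AmplificationChainSiegel`), or HC for the
members of GENERAL Weil type given cofinal seeded members (`ComponentLadderG2nCofinal`) — never all Weil-type members, i.e. never `HC_AV`).
This file does, ONCE FOR ALL DOORS, and instantiates (other perfect-complex doors instantiate O-2′ by dot notation: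
`PerfectComplexSigmaTransfer.localVariationalHodgeFor`, `PerfectComplexRankTransfer.localVariationalHodgeFor`).

## Rows (kernel-checked; `Lift 𝒪 := UniformObjLiftAtCM 𝒪`, `LVH 𝒪 := LocalVariationalHodgeFor 𝒪`)

| row | theorem | hypotheses (each NAMED) | conclusion |
|---|---|---|---|
| O-1 | `localVHCAtCM_of_localVariationalHodgeFor_of_uniformObjLift` | `LVH 𝒪`, `Lift 𝒪` | ring 2's CM-germ leaf `LocalVHCAtCM` |
| O-2/2′ | `hc_av_of_hc_cm_of_{cmAnchoredFamilies,deligne1982}_of_localVariationalHodgeFor_of_uniformObjLift` | `HC_CM`, `CMAnchoredFamilies` / Deligne 1982 Prop. 6.1 (fact), `LVH 𝒪`, `Lift 𝒪` | `HC_AV` |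
| O-3 | `hodgeWeilType_of_hc_cm_of_deligne1982_of_localVariationalHodgeFor_of_uniformObjLift` | same | `Ring2Transport.HodgeWeilType` (`↔ HC_AV`, ring 2) |
| O-4 | `cmToAbelian_of_cmAnchoredFamilies_of_localVariationalHodgeFor_of_uniformObjLift` | no `HC_CM` | `Theses.RankFourFaces.CMToAbelian` |
| O-L2 | `hc_cm_of_andre_…` / `hc_av_of_andre_…_uniformObjLift` | André 1992, P₂, P₃ (ring 2's anchor leaves), [Deligne], `LVH 𝒪`, `Lift 𝒪` | `HC_CM` / `HC_AV`, `HC_CM` occurring ZERO times |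
| O-5 | `generalStructure_position_objClass` | — | conjunction of tree theorems: what `Lift 𝒪 ∧ LVH 𝒪` is sufficient FOR |
| P-2′/2″ | `hc_av_of_hc_cm_of_deligne1982_of_pridhamPerfect_of_{algebraisesLifts,versalCharts}_of_uniformGluableSigmaLift` | `HC_CM`, Deligne, `PridhamPerfectLifts C`, `PerfectComplexAlgebraisesLifts C` / Lieblich-type versal charts, `Lift (perfectObjClass C gluableSigmaAdmissible)` | `HC_AV` |
| P-2‴ | `…_of_uniformSigmaLift` | the narrower σ-door (`Hom = ℂ`), via `UniformObjLiftAtCM.mono` — no transfer statement by name | `HC_AV` |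
| P-L2 | `hc_cm_and_hc_av_of_andre_of_anchors_of_deligne1982_of_pridhamPerfect_of_algebraisesLifts_of_uniformGluableSigmaLift` | André, P₂, P₃, Deligne, Pridham, algebraisation, `Lift (perfect)` | `HC_CM ∧ HC_AV` |
| S-0 | `uniformObjLift_bfSheafClass_of_uniformSheafLift` | — | gs-g4's sheaf ∀-form IS the instance `𝒪 = bfSheafClass C` (sanity: the abstraction loses nothing) |
| S-2′ | `hc_av_of_hc_cm_of_deligne1982_of_BFmodel_of_uniformSheafLift` | `HC_CM`, Deligne, BF 5.1 (model rendering), sheaf ∀-form | `HC_AV` (seat G4's 2026-08-22 row, re-derived through O-2′) |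

So the END STATEMENT reads, for EVERY object class `𝒪`: **`HC_AV` modulo {`HC_CM`, Deligne 1982 Prop. 6.1, `LocalVariationalHodgeFor 𝒪`,
`UniformObjLiftAtCM 𝒪`}**; on the perfect-complex door: **`HC_AV` modulo {`HC_CM`, Deligne 1982 Prop. 6.1, Pridham 2024 Cor. 2.25, Lieblich-type
versal charts, the team's uniform gluable-σ lift at CM fibres}** — three printed inputs by name, one open item, one speculative hypothesis of ours.

The two hypotheses pull in OPPOSITE directions in `𝒪` (`UniformObjLiftAtCM.mono` vs p7's `LocalVariationalHodgeFor.anti`): a WIDER class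
is easier to lift into and needs a STRONGER transfer theorem (used in P-2‴). Doors with both sides typed: sheaves (BF 5.1; lift plausibly
false), perfect complexes (Pridham 2024 + versal charts; lift = the census question); Bloch lci separately (`UniformBlochLiftAtCM`).

## VACUITY LEDGER (T5-style derive-`False` check; for RED-GS; numbers, not adjectives)

(i) On-path: every hypothesis of O-2′ EXCEPT `Lift 𝒪` and `LVH 𝒪` is a binder for an open item implied by the summit
(`HC_CM`) or a refereed theorem typed as a named fact (Deligne 1982 Prop. 6.1); with Catanese 2002 the summit gives the
CONCLUSION of O-1 itself (`GeneralStructure.bundle_sans_uniformLift_of_hodgeConjecture`, seat G4, by name) — so `False`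
follows from a bundle only if it follows from `HodgeConjecture ∧` print `∧ Lift 𝒪 ∧ LVH 𝒪`. (ii) `Lift 𝒪` has NO on-path
lemma (its conclusion asserts objects of class `𝒪`); it is genuinely extra; HONEST LABEL inherited from ring 2's referee
(ref1 F5) and RED-GS GS-9: PLAUSIBLY FALSE AS A `∀`-STATEMENT for every door tried; its deformation-free shadow over the
point base is the presentation statement (★) of `GeneralStructureStar.lean`. (iii) Not vacuously true: the antecedents are
literally those of `LocalVHCAtCM`, jointly satisfiable (ring 2's
`CMPivot.Stubs.localVHCAtCM_hypotheses_nonempty`). (iv) `LVH (perfectObjClass C gluableSigmaAdmissible)` is NOT taken by name on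
rows P: it is DERIVED from `PridhamPerfectLifts C` + the algebraisation / versal charts (tree theorems of seats p7 / th-3). (v) HIDDEN
PARAMETER (red-1 V2-L4, carried): every row is parametrised by `C : ChernCharacterBetti`, of which the tree vendors no instance. (vi) GS-K1
(2026-08-23): no census object at `n ≥ 4` passed both the exact-class and the computed-semiregularity tests; nothing here asserts such an
object. AUDIT: every theorem concluding `HC_AV`, `HodgeWeilType`, `CMToAbelian` or `HC_CM` has `UniformObjLiftAtCM 𝒪` (or its sheaf /
σ instance) among its hypotheses, plus named printed facts and — where load-bearing — `HC_CM` by name.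

## References (bib keys)

BuchweitzFlenner2003 (§5 Thm. 5.1, Def. 4.1), Pridham2024Semiregularity (Cor. 2.25, Rem. 2.27), Lieblich2006 (Thm. 4.2.1), Perry2022 (Prop. 8.1),
Deligne1982HodgeCycles (Prop. 6.1; §4 Lemma 4.5, Rem. 4.10), CharlesSchnell2014Notes (Prop. 11.3.11, Thm. 11.5.11), Andre1992HodgeCM,
Gordon1997 (Thm. 6.4), Catanese2002DeformationTypes (§4 Thm. 4.1), VoisinHodgeI2002 (§9.2.1), Markman2025SurveySecant (Q. 11.4; preprint).
-/

noncomputable section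

open CategoryTheory
open Literature.AlgebraicGeometry Literature.AlgebraicGeometry.Motives
open Literature.AlgebraicGeometry.HodgeTheory Literature.AlgebraicGeometry.KTheory
open Literature.AlgebraicGeometry.Deligne1982 (deligne1982_cmDenseMumfordTateFamilies)

namespace Summit.Ventures.HSemireg.GeneralStructure

open Summit.HodgeConjecture.HodgeConjecture
open Summit.HodgeConjecture.HodgeConjecture.Ring2.Hypotheses (CMAnchoredFamilies LocalVHCAtCM
  hc_av_of_hc_cm_of_cmAnchoredFamilies_of_localVHCAtCM cmToAbelian_of_cmAnchoredFamilies_of_localVHCAtCM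
  HC_CM_of_andre_of_divisorGeneratedCMPointed_of_localVHCAtCM
  HC_AV_of_andre_of_divisorGeneratedCMPointed_of_cmAnchoredFamilies_of_localVHCAtCM)
open Summit.HodgeConjecture.HodgeConjecture.Ring2Transport (HodgeWeilType pathIn transportFun_pathIn_mono
  hodgeAbelianVarieties_iff_hodgeWeilType DivisorGeneratedCMPointedWeilFamiliesQuadratic
  DivisorGeneratedCMPointedWeilFamiliesCMField)

/-! ### §0 The CM-pivot vocabulary (verbatim ring 2's local notations: the hypothesis below has LITERALLY `LocalVHCAtCM`'s antecedents) -/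

/-- `IsCM[A]` — CM type in the eigenvalue typing (verbatim `Ring2HypothesesCMPivot`). Local notation only. -/
local notation3 (prettyPrint := false) "IsCM[" A "]" =>
  ∃ (ψ : A ⟶ A) (μ : Fin (2 * AbelianVariety.dim A) → ℂ), Function.Injective μ ∧
    ∀ i, Module.End.HasEigenvalue (HodgeTheory.complexBetti.map ψ.hom.hom.hom 1).hom (μ i)

/-- `QProj[X]` — `X` quasi-projective over `ℂ` (inlined body of `HodgeTheory.IsQuasiProjectiveOver X`). Local notation only. -/
local notation3 (prettyPrint := false) "QProj[" X "]" =>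
  ∃ (P : SchemeOver ℂ) (j : X ⟶ P), IsProjectiveOver P ∧ AlgebraicGeometry.IsOpenImmersion j.left

/-- `FibreIncl[f, B, e, s]` — `e` presents `B` as the fibre of `f` over `s`. Local notation only. -/
local notation3 (prettyPrint := false) "FibreIncl[" f ", " B ", " e ", " s "]" =>
  ∃ i : AbelianVariety.X B ≅ fiberOver f s, e = CategoryStruct.comp i.hom (fiberι f s)

/-- `HodgeAlong[S, 𝒳, f, G, p]` — `G` is rational `(p,p)` on every fibre presented as an abelian variety. Local notation only. -/
local notation3 (prettyPrint := false) "HodgeAlong[" S ", " 𝒳 ", " f ", " G ", " p "]" =>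
  ∀ (B : AbelianVariety ℂ) (eB : AbelianVariety.X B ⟶ 𝒳) (u : ComplexPoints S),
    FibreIncl[f, B, eB, u] →
      HodgeTheory.IsRationalClass (HodgeTheory.complexBetti.map eB (2 * p) G) ∧
      HodgeTheory.IsOfHodgeType B.dim B.X (2 * p) p p (HodgeTheory.complexBetti.map eB (2 * p) G)

/-! ### §1 The team's hypothesis in an ARBITRARY object class `𝒪` -/

/-- **`UniformObjLiftAtCM 𝒪` — UNIFORM `𝒪`-ADMISSIBLE PRESENTATIONS AT CM FIBRES (the «general structure» hypothesis of
cell `pub-hsemireg`, team G, in the door-agnostic currency of the cell's amplification chain; OURS, SPECULATIVE, OPEN — NOT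
a Literature fact, never asserted).** In EXACTLY the antecedents of ring 2's CM-germ leaf `Ring2.Hypotheses.LocalVHCAtCM`
(a smooth projective family `f : 𝒳 ⟶ S` of relative dimension `m`, `𝒳` and `S` quasi-projective, `S` smooth irreducible,
a CM abelian fibre `A₀ ≅ 𝒳_{s₀}`, a global class `G ∈ H^{2p}(𝒳(ℂ); ℂ)` rational `(p,p)` on every fibre presented as an
abelian variety, whose value on `A₀` is ALGEBRAIC — which is what `HC_CM` delivers): there are a Euclidean-open `U ∋ s₀`,
a MODEL `e : X₀ ≅ 𝒳_{s₀}` of the CM fibre (in the census: `E^{2n}` with its product structure), finitely many families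
of classes `κ_i = (κ_{i,q})_q` on `X₀` with finite degree sets `I_i ∋ p`, each `𝒪`-ADMISSIBLE in relative dimension `m`
(`𝒪 m X₀ I_i κ_i`: «the classes of an admissible object of kind `𝒪`» — an `I_i`-semiregular vector bundle, a gluable
σ-semiregular perfect complex, …), complex coefficients `c_i` with `G|_{𝒳_{s₀}} = Σ_i c_i · (e⁻¹)^* κ_{i,p}`, and, for
every `i` and `q ∈ I_i`, the flat transport of `(e⁻¹)^* κ_{i,q}` along every path in `U` from `s₀` of type `(q,q)` —
exactly the hypothesis package of `LocalVariationalHodgeFor 𝒪`, `ℂ`-linearly extended. INSTANCES: `𝒪 = bfSheafClass C`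
gives back seat G4's `UniformSemiregularSheafLiftAtCM C` (`uniformObjLift_bfSheafClass_of_uniformSheafLift`);
`𝒪 = perfectObjClass C gluableSigmaAdmissible` is the perfect-complex door of the cell's census. HONEST LABEL (ring 2's
referee ruling ref1 F5; RED-GS GS-9): PLAUSIBLY FALSE AS A `∀`-STATEMENT (obstructed representatives are generic; preferred
form = per-family witnesses; deformation-free shadow = the presentation statement (★) of `GeneralStructureStar.lean`, with
content only in the deep middle `2 ≤ p ≤ m - 2`); NOT a case of HC (it asserts objects), so no on-path lemma; the cell's GS-K1
census (2026-08-23) found NO object passing both tests at `n ≥ 4`. CLOSEST PRINT (semiregular object GIVEN, never produced from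
algebraicity): Bloch 1972 (7.1); BF 2003 5.1; Pridham 2024 2.25; Markman arXiv:2509.23403 Q. 11.4 sentence 1 (open). [status: open, speculative]
[cite: BuchweitzFlenner2003, §5 Thm. 5.1 and Def. 4.1] [cite: Markman2025SurveySecant, Question 11.4 sentence 1 (preprint, unrefereed; statement only)] -/
@[conjecture] def UniformObjLiftAtCM (𝒪 : ObjClass) : Prop :=
  ∀ (S 𝒳 : SchemeOver ℂ) (f : 𝒳 ⟶ S) (m p : ℕ) (G : HodgeTheory.complexBetti 𝒳 (2 * p))
    (s₀ : ComplexPoints S) (A₀ : AbelianVariety ℂ) (e₀ : A₀.X ⟶ 𝒳),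
    QProj[𝒳] → QProj[S] → AlgebraicGeometry.Smooth S.hom → IrreducibleSpace S.left →
    IsSmoothProjectiveFamily f m →
    FibreIncl[f, A₀, e₀, s₀] → IsCM[A₀] →
    HodgeTheory.complexBetti.map e₀ (2 * p) G ∈ HodgeTheory.algebraicClasses A₀.X p →
    HodgeAlong[S, 𝒳, f, G, p] →
    ∃ (U : Set (ComplexPoints S)) (hs₀ : s₀ ∈ U), IsOpen U ∧
      ∃ (X₀ : SchemeOver ℂ) (e : X₀ ≅ fiberOver f s₀) (r : ℕ) (c : Fin r → ℂ) (I : Fin r → Finset ℕ)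
        (κ : Fin r → (q : ℕ) → complexBetti X₀ (2 * q)),
        (∀ i, p ∈ I i) ∧ (∀ i, 𝒪 m X₀ (I i) (κ i)) ∧
        complexBetti.map (fiberι f s₀) (2 * p) G = ∑ i, c i • complexBetti.map e.inv (2 * p) (κ i p) ∧
        ∀ (hU : IsCohomologicallyLocallyTrivialOn f U) (i : Fin r), ∀ q ∈ I i,
          ∀ (t : U) (γ : Path.Homotopic.Quotient (⟨s₀, hs₀⟩ : U) t),
            IsOfHodgeType m (fiberOver f t.1) (2 * q) q q
              (transportFun f (2 * q) hU γ (complexBetti.map e.inv (2 * q) (κ i q)))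

/-- **Monotonicity in the object class**: a presentation by objects of a narrower class is a presentation by objects of any
wider class (`𝒪 ≤ 𝒪' ⟹ UniformObjLiftAtCM 𝒪 → UniformObjLiftAtCM 𝒪'`). Opposite variance to p7's
`LocalVariationalHodgeFor.anti`. [folklore] -/
theorem UniformObjLiftAtCM.mono {𝒪 𝒪' : ObjClass} (h𝒪 : ∀ n X₀ I κ, 𝒪 n X₀ I κ → 𝒪' n X₀ I κ)
    (h : UniformObjLiftAtCM 𝒪) : UniformObjLiftAtCM 𝒪' := by
  intro S 𝒳 f m p G s₀ A₀ e₀ h𝒳 hS hsm hirr hf hA₀ hCM halg hG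
  obtain ⟨U, hs₀U, hUo, X₀, e, r, c, I, κ, hpI, hκ, hsum, hHodge⟩ :=
    h S 𝒳 f m p G s₀ A₀ e₀ h𝒳 hS hsm hirr hf hA₀ hCM halg hG
  exact ⟨U, hs₀U, hUo, X₀, e, r, c, I, κ, hpI, fun i ↦ h𝒪 _ _ _ _ (hκ i), hsum, hHodge⟩

/-! ### §2 Row O-1: the local variational statement FOR `𝒪` transports the uniform `𝒪`-lift into ring 2's CM-germ leaf -/

/-- **O-1 — `LocalVHCAtCM` from `LocalVariationalHodgeFor 𝒪` and `UniformObjLiftAtCM 𝒪` (kernel-checked, every door at once).**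
At a CM-charted algebraic fibre `s₀`: write `G|_{s₀} = Σ c_i (e⁻¹)^*κ_{i,p}` (the lift); the whole base is cohomologically locally
trivial (Ehresmann), so the local variational statement for `𝒪`, applied object by object at the model `e`, gives opens `W_i ∋ s₀` over
which the transports of `(e⁻¹)^*κ_{i,p}` are algebraic; on the path component `V` of `s₀` in `U ∩ ⋂ W_i` (open: `S(ℂ)` is locally path
connected) every `t` is joined to `s₀` by a path `γ ⊂ V`, and `G|_{𝒳_t} = γ_*(G|_{s₀}) = Σ c_i γ_*((e⁻¹)^*κ_{i,p})` (restrictions of global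
classes are flat; transport is `ℂ`-linear) is algebraic. Proof = seat G4's sheaf row with `ch_p(E_i)` ↦ `(e⁻¹)^*κ_{i,p}`, BF 5.1 ↦
`LocalVariationalHodgeFor 𝒪`; the CM hypothesis and the chart are IDLE here (they only restrict WHERE the lift is asked).
[cite: BuchweitzFlenner2003, §5 Thm. 5.1 (the argument shape)] [cite: VoisinHodgeI2002, §9.2.1] -/
theorem localVHCAtCM_of_localVariationalHodgeFor_of_uniformObjLift (𝒪 : ObjClass) (hT : LocalVariationalHodgeFor 𝒪)
    (hL : UniformObjLiftAtCM 𝒪) : LocalVHCAtCM := by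
  intro S 𝒳 f m p G s₀ A₀ e₀ h𝒳 hS hsm hirr hf hA₀ hCM halg hG
  obtain ⟨U, hs₀U, hUo, X₀, e, r, c, I, κ, hpI, hκ, hsum, hHodge⟩ :=
    hL S 𝒳 f m p G s₀ A₀ e₀ h𝒳 hS hsm hirr hf hA₀ hCM halg hG
  have hqS : IsQuasiProjectiveOver S := hS
  have hU : IsCohomologicallyLocallyTrivialOn f U :=
    (isCohomologicallyLocallyTrivialOn_univ_of_isQuasiProjectiveOver f hf hqS hsm).mono (Set.subset_univ U) hUo
  -- the local variational statement for `𝒪`, object by object, at the model `e`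
  have hTi : ∀ i : Fin r, ∃ (Wi : Set (ComplexPoints S)) (hWo : IsOpen Wi) (hW₀ : s₀ ∈ Wi) (hWU : Wi ⊆ U),
      ∀ (t : Wi) (γ : Path.Homotopic.Quotient (⟨s₀, hW₀⟩ : Wi) t),
        transportFun f (2 * p) (hU.mono hWU hWo) γ (complexBetti.map e.inv (2 * p) (κ i p)) ∈
          algebraicClasses (fiberOver f t.1) p := by
    intro i
    obtain ⟨Wi, hWo, hW₀, hWU, h⟩ := hT f m hf hsm hU ⟨s₀, hs₀U⟩ X₀ e (I i) (κ i) (hκ i)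
      (fun q hq t γ ↦ hHodge hU i q hq t γ)
    exact ⟨Wi, hWo, hW₀, hWU, fun t γ ↦ h p (hpI i) t γ⟩
  choose Wi hWio hW₀i hWiU hWialg using hTi
  -- the path component of `s₀` in `U ∩ ⋂ Wi`
  haveI := hsm
  haveI : LocallyPathConnectedSpace (ComplexPoints S) := locallyPathConnectedSpace_complexPoints_of_smooth S
  set W₀ : Set (ComplexPoints S) := U ∩ ⋂ i, Wi i with hW₀def
  have hW₀o : IsOpen W₀ := hUo.inter (isOpen_iInter_of_finite hWio)
  have hs₀W₀ : s₀ ∈ W₀ := ⟨hs₀U, Set.mem_iInter.2 hW₀i⟩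
  refine ⟨pathComponentIn W₀ s₀, hW₀o.pathComponentIn s₀, mem_pathComponentIn_self hs₀W₀, fun t ht ↦ ?_⟩
  have hJ : JoinedIn W₀ s₀ t := ht
  set γ₀ : Path s₀ t := hJ.somePath
  have hγ : ∀ ρ, γ₀ ρ ∈ W₀ := hJ.somePath_mem
  have hγU : ∀ ρ, γ₀ ρ ∈ U := fun ρ ↦ (hγ ρ).1
  have hγi : ∀ i ρ, γ₀ ρ ∈ Wi i := fun i ρ ↦ Set.mem_iInter.1 (hγ ρ).2 i
  -- `G|_{𝒳_t}` is the transport of `G|_{𝒳_{s₀}}` along `γ₀` (in `U`)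
  have hGt : complexBetti.map (fiberι f t) (2 * p) G =
      transportFun f (2 * p) hU ⟦pathIn γ₀ U hγU⟧ (complexBetti.map (fiberι f s₀) (2 * p) G) :=
    (transportFun_map_fiberι f (2 * p) hU ⟦pathIn γ₀ U hγU⟧ G).symm
  have hlin : transportFun f (2 * p) hU ⟦pathIn γ₀ U hγU⟧ (∑ i, c i • complexBetti.map e.inv (2 * p) (κ i p)) =
      ∑ i, c i • transportFun f (2 * p) hU ⟦pathIn γ₀ U hγU⟧ (complexBetti.map e.inv (2 * p) (κ i p)) := by
    simp only [← transportLinear_apply, map_sum, map_smul]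
  rw [hGt, hsum, hlin]
  refine Submodule.sum_mem _ fun i _ ↦ Submodule.smul_mem _ (c i) ?_
  have hi := hWialg i ⟨t, hγi i 1 |> fun h ↦ γ₀.target ▸ h⟩ ⟦pathIn γ₀ (Wi i) (hγi i)⟧
  rw [transportFun_pathIn_mono f (2 * p) hU (hWiU i) (hWio i) γ₀ (hγi i)] at hi
  exact hi

/-! ### §3 Rows O-2 … O-5: the end statement `HC_AV` (≡ `HodgeWeilType`) modulo named hypotheses, for every door `𝒪` -/

/-- **O-2 — `HC_CM ∧ CMAnchoredFamilies ∧ LocalVariationalHodgeFor 𝒪 ∧ UniformObjLiftAtCM 𝒪 ⟹ HC_AV`** (O-1 composed with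
ring 2's CM pivot `hc_av_of_hc_cm_of_cmAnchoredFamilies_of_localVHCAtCM`, whose germ-to-global step — the algebraicity
locus is a countable union of closed algebraic subsets of the irreducible base — is proved in the tree). `HC_CM` is
load-bearing (it makes the CM fibre an algebraic anchor) and is consumed exactly once.
[cite: Deligne1982HodgeCycles, Prop. 6.1] [cite: CharlesSchnell2014Notes, Prop. 11.3.11 (proof)] -/
theorem hc_av_of_hc_cm_of_cmAnchoredFamilies_of_localVariationalHodgeFor_of_uniformObjLift {𝒪 : ObjClass}
    (hCM : Theses.RankFourFaces.CMAbelianHodge) (hMT : CMAnchoredFamilies) (hT : LocalVariationalHodgeFor 𝒪)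
    (hL : UniformObjLiftAtCM 𝒪) : Theses.PadicSemiregularLift.HodgeAbelianVarieties :=
  hc_av_of_hc_cm_of_cmAnchoredFamilies_of_localVHCAtCM hCM hMT
    (localVHCAtCM_of_localVariationalHodgeFor_of_uniformObjLift 𝒪 hT hL)

/-- **O-2′ — the same with the anchors supplied by PRINT**: `HC_CM ∧ [Deligne 1982 Prop. 6.1, dense form = Charles–Schnell
Thm. 11.5.11] ∧ LocalVariationalHodgeFor 𝒪 ∧ UniformObjLiftAtCM 𝒪 ⟹ HC_AV`. THIS is the end statement of seat G4 in
door-agnostic form: **`HC_AV` modulo (`HC_CM`, one printed theorem, the transfer theorem FOR `𝒪`, the team's uniform `𝒪`-lift)**.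
[cite: Deligne1982HodgeCycles, Prop. 6.1] [cite: CharlesSchnell2014Notes, Thm. 11.5.11] -/
theorem hc_av_of_hc_cm_of_deligne1982_of_localVariationalHodgeFor_of_uniformObjLift {𝒪 : ObjClass}
    (hCM : Theses.RankFourFaces.CMAbelianHodge) (hD : deligne1982_cmDenseMumfordTateFamilies)
    (hT : LocalVariationalHodgeFor 𝒪) (hL : UniformObjLiftAtCM 𝒪) : Theses.PadicSemiregularLift.HodgeAbelianVarieties :=
  hc_av_of_hc_cm_of_cmAnchoredFamilies_of_localVariationalHodgeFor_of_uniformObjLift hCM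
    (Ring2.Deform.cmAnchoredFamilies_of_deligne1982 hD) hT hL

/-- **O-3 — the coordinator's phrasing: the bundle gives `HodgeWeilType`** (HC for EVERY complex abelian variety of Weil
type), by ring 2's EXACTNESS theorem `Ring2Transport.hodgeAbelianVarieties_iff_hodgeWeilType : HC_AV ↔ HodgeWeilType`;
read together with O-2′ the END STATEMENT is `HC_AV`, `HodgeWeilType` is not a proper intermediate.
[cite: Deligne1982HodgeCycles, §4 Lemma 4.5 and Remark 4.10] -/
theorem hodgeWeilType_of_hc_cm_of_deligne1982_of_localVariationalHodgeFor_of_uniformObjLift {𝒪 : ObjClass}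
    (hCM : Theses.RankFourFaces.CMAbelianHodge) (hD : deligne1982_cmDenseMumfordTateFamilies)
    (hT : LocalVariationalHodgeFor 𝒪) (hL : UniformObjLiftAtCM 𝒪) : HodgeWeilType :=
  hodgeAbelianVarieties_iff_hodgeWeilType.1
    (hc_av_of_hc_cm_of_deligne1982_of_localVariationalHodgeFor_of_uniformObjLift hCM hD hT hL)

/-- **O-4 — the TRANSPORT HALF alone, no `HC_CM`**: `CMAnchoredFamilies ∧ LocalVariationalHodgeFor 𝒪 ∧ UniformObjLiftAtCM 𝒪
⟹ CMToAbelian` (the open route item `HC_CM → HC_AV`, stmt-HodgeConjecture-16267). [cite: Deligne1982HodgeCycles, Prop. 6.1] -/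
theorem cmToAbelian_of_cmAnchoredFamilies_of_localVariationalHodgeFor_of_uniformObjLift {𝒪 : ObjClass}
    (hMT : CMAnchoredFamilies) (hT : LocalVariationalHodgeFor 𝒪) (hL : UniformObjLiftAtCM 𝒪) :
    Theses.RankFourFaces.CMToAbelian :=
  cmToAbelian_of_cmAnchoredFamilies_of_localVHCAtCM hMT (localVHCAtCM_of_localVariationalHodgeFor_of_uniformObjLift 𝒪 hT hL)

/-- **O-L2-cm — `HC_CM` DISCHARGED on the door-agnostic row** (ring 2's domination G3
`HC_CM_of_andre_of_divisorGeneratedCMPointed_of_localVHCAtCM` ∘ O-1): André 1992 (refereed named fact) ∧ ring 2's two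
divisor-generated CM-pointed anchor leaves P₂ (quadratic; in print) / P₃ (CM fields; in print for anchor-good CM fields ONLY
— ring 2's transport-seat caveat, carried verbatim) ∧ `LocalVariationalHodgeFor 𝒪` ∧ `UniformObjLiftAtCM 𝒪` ⟹ `HC_CM`.
NOT a proof sketch of `HC_CM` (the lift is speculative; P₂/P₃ are open leaves). [cite: Andre1992HodgeCM, Théorème]
[cite: Gordon1997, Thm. 6.4 and Prop. 9.4.1] -/
theorem hc_cm_of_andre_of_anchors_of_localVariationalHodgeFor_of_uniformObjLift {𝒪 : ObjClass}
    (hA : Andre1992_hodgeClasses_cmAbelianVariety_mem_span_pullback_weilClasses)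
    (hP₂ : DivisorGeneratedCMPointedWeilFamiliesQuadratic) (hP₃ : DivisorGeneratedCMPointedWeilFamiliesCMField)
    (hT : LocalVariationalHodgeFor 𝒪) (hL : UniformObjLiftAtCM 𝒪) : Theses.RankFourFaces.CMAbelianHodge :=
  HC_CM_of_andre_of_divisorGeneratedCMPointed_of_localVHCAtCM hA hP₂ hP₃
    (localVHCAtCM_of_localVariationalHodgeFor_of_uniformObjLift 𝒪 hT hL)

/-- **O-L2′ — `HC_AV` with `HC_CM` occurring ZERO times**: André ∧ P₂ ∧ P₃ ∧ [Deligne 1982 Prop. 6.1] ∧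
`LocalVariationalHodgeFor 𝒪` ∧ `UniformObjLiftAtCM 𝒪` ⟹ `HC_AV` (ring 2's G4 ∘ O-1). [cite: Andre1992HodgeCM, Théorème]
[cite: Deligne1982HodgeCycles, Prop. 6.1] [cite: CharlesSchnell2014Notes, Thm. 11.5.11] -/
theorem hc_av_of_andre_of_anchors_of_deligne1982_of_localVariationalHodgeFor_of_uniformObjLift {𝒪 : ObjClass}
    (hA : Andre1992_hodgeClasses_cmAbelianVariety_mem_span_pullback_weilClasses)
    (hP₂ : DivisorGeneratedCMPointedWeilFamiliesQuadratic) (hP₃ : DivisorGeneratedCMPointedWeilFamiliesCMField)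
    (hD : deligne1982_cmDenseMumfordTateFamilies) (hT : LocalVariationalHodgeFor 𝒪) (hL : UniformObjLiftAtCM 𝒪) :
    Theses.PadicSemiregularLift.HodgeAbelianVarieties :=
  HC_AV_of_andre_of_divisorGeneratedCMPointed_of_cmAnchoredFamilies_of_localVHCAtCM hA hP₂ hP₃
    (Ring2.Deform.cmAnchoredFamilies_of_deligne1982 hD) (localVHCAtCM_of_localVariationalHodgeFor_of_uniformObjLift 𝒪 hT hL)

/-- **O-5 — POSITION (kernel-checked conjunction of tree theorems, no new content).** (a) the uniform `𝒪`-lift + the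
transfer theorem for `𝒪` give ring 2's CM-germ leaf `LocalVHCAtCM`; (b) granted Deligne 1982 Prop. 6.1 and Catanese 2002, that leaf is
EXACTLY what `HC_CM` must be supplemented by: `CMToAbelian ↔ (HC_CM → LocalVHCAtCM)` (ring 2); (c) `HC_AV ↔ HodgeWeilType`
(ring 2): no Weil-confined datum (Weil CLASSES on Weil components — what the census computes) closes the target without a
transport input of the strength of (b); the uniform `𝒪`-lift, asked on ALL CM-anchored families, is such an input.
[cite: Deligne1982HodgeCycles, Prop. 6.1 and §4] [cite: Catanese2002DeformationTypes, §4 Thm. 4.1 and Thm. 4.6] -/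
theorem generalStructure_position_objClass (𝒪 : ObjClass) :
    (LocalVariationalHodgeFor 𝒪 → UniformObjLiftAtCM 𝒪 → LocalVHCAtCM) ∧
    (deligne1982_cmDenseMumfordTateFamilies → catanese2002_abelianFibres_of_abelianFibre →
      (Theses.RankFourFaces.CMToAbelian ↔ (Theses.RankFourFaces.CMAbelianHodge → LocalVHCAtCM))) ∧
    (Theses.PadicSemiregularLift.HodgeAbelianVarieties ↔ HodgeWeilType) :=
  ⟨localVHCAtCM_of_localVariationalHodgeFor_of_uniformObjLift 𝒪,
    Ring2.Binders.cmToAbelian_iff_localVHCAtCM_of_hc_cm_of_deligne1982_of_catanese2002,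
    hodgeAbelianVarieties_iff_hodgeWeilType⟩

/-! ### §4 The PERFECT-COMPLEX door (gluable σ-class): `LocalVariationalHodgeFor` is DERIVED (p7 / th-3), so the end statement
reads `HC_AV` modulo {`HC_CM`, Deligne 1982, Pridham 2024 Cor. 2.25, the Hodge-free algebraisation / versal charts, the
uniform gluable-σ lift} -/

/-- **P-2′ — `HC_CM ∧ [Deligne 1982] ∧ PridhamPerfectLifts C ∧ PerfectComplexAlgebraisesLifts C ∧
UniformObjLiftAtCM (perfectObjClass C gluableSigmaAdmissible) ⟹ HC_AV`.** The transfer theorem for the gluable σ-class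
is the tree theorem `localVariationalHodgeFor_gluable_of_pridhamPerfect_of_algebraisesLifts` ([Pridham2024] Cor. 2.25 +
Rem. 2.27 typed by name as `PridhamPerfectLifts C`; the Hodge-free algebraisation `PerfectComplexAlgebraisesLifts C`).
The lift asks, at every CM-charted algebraic fibre, for bounded complexes of vector bundles `E_i` on a model of the fibre
with `{1, …, m} ⊆ I_i ∋ p`, `Ext^{<0}(E_i, E_i) = 0`, `(σ_q(E_i))_{q+1 ∈ I_i}` jointly injective, `G|_{s₀} = Σ c_i ch_p(E_i)`
and `ch_q(E_i)`, `q ∈ I_i`, horizontal of type `(q,q)` near `s₀`. [cite: Pridham2024Semiregularity, Cor. 2.25 and Rem. 2.27]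
[cite: Perry2022, proof of Prop. 8.1] [cite: Deligne1982HodgeCycles, Prop. 6.1] -/
theorem hc_av_of_hc_cm_of_deligne1982_of_pridhamPerfect_of_algebraisesLifts_of_uniformGluableSigmaLift
    (C : ChernCharacterBetti) (hCM : Theses.RankFourFaces.CMAbelianHodge) (hD : deligne1982_cmDenseMumfordTateFamilies)
    (hP : PridhamPerfectLifts C) (hAlg : PerfectComplexAlgebraisesLifts C)
    (hL : UniformObjLiftAtCM (perfectObjClass C gluableSigmaAdmissible)) :
    Theses.PadicSemiregularLift.HodgeAbelianVarieties :=
  hc_av_of_hc_cm_of_deligne1982_of_localVariationalHodgeFor_of_uniformObjLift hCM hD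
    (localVariationalHodgeFor_gluable_of_pridhamPerfect_of_algebraisesLifts hP hAlg) hL

/-- **P-2″ — the same on the cell's split TRUST BASE: Lieblich-type VERSAL CHARTS in place of the algebraisation** (by name:
`HasVersalPerfectChartAt` for every bounded complex of vector bundles with `Ext^{<0} = 0` on every smooth projective family over
a smooth base — versality in EXISTENCE form; the algebraisation is then KERNEL, `perfectComplexAlgebraisesLifts_of_versalCharts`,
EGA IV 17.14.2 / 17.16.3 (i) discharged in the tree): `HC_CM ∧ [Deligne 1982] ∧ PridhamPerfectLifts C ∧ [versal charts] ∧
UniformObjLiftAtCM (perfectObjClass C gluableSigmaAdmissible) ⟹ HC_AV`. **This is the G4 end statement on the door of the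
cell's only YES (g = 4).** [cite: Pridham2024Semiregularity, Cor. 2.25 and Rem. 2.27] [cite: Lieblich2006, Thm. 4.2.1]
[cite: Deligne1982HodgeCycles, Prop. 6.1] -/
theorem hc_av_of_hc_cm_of_deligne1982_of_pridhamPerfect_of_versalCharts_of_uniformGluableSigmaLift
    (C : ChernCharacterBetti) (hCM : Theses.RankFourFaces.CMAbelianHodge) (hD : deligne1982_cmDenseMumfordTateFamilies)
    (hP : PridhamPerfectLifts C)
    (hV : ∀ ⦃𝒳 S : SchemeOver ℂ⦄ (π : 𝒳 ⟶ S) (n : ℕ),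
      IsSmoothProjectiveFamily π n → _root_.AlgebraicGeometry.Smooth S.hom →
      ∀ (s₀ : ComplexPoints S) (X₀ : SchemeOver ℂ) (e : X₀ ≅ fiberOver π s₀)
        (E : CochainComplex X₀.left.Modules ℤ), IsBoundedVBComplex E →
        (∀ k : ℤ, k < 0 → extRank X₀ E k = 0) → HasVersalPerfectChartAt π s₀ X₀ e E)
    (hL : UniformObjLiftAtCM (perfectObjClass C gluableSigmaAdmissible)) :
    Theses.PadicSemiregularLift.HodgeAbelianVarieties :=
  hc_av_of_hc_cm_of_deligne1982_of_pridhamPerfect_of_algebraisesLifts_of_uniformGluableSigmaLift C hCM hD hP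
    (perfectComplexAlgebraisesLifts_of_versalCharts hV C) hL

/-- **P-2‴ — the narrower σ-door (`Hom(E,E) = ℂ` added; target seat 7's `sigmaAdmissible`) needs NO transfer statement by name**:
`sigmaObjClass C ≤ perfectObjClass C gluableSigmaAdmissible` (`perfectObjClass_gluable_of_sigma`), so its uniform lift is a gluable
uniform lift (`UniformObjLiftAtCM.mono`) and P-2′ applies. [cite: Pridham2024Semiregularity, Cor. 2.25 and Rem. 2.27] -/
theorem hc_av_of_hc_cm_of_deligne1982_of_pridhamPerfect_of_algebraisesLifts_of_uniformSigmaLift (C : ChernCharacterBetti)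
    (hCM : Theses.RankFourFaces.CMAbelianHodge) (hD : deligne1982_cmDenseMumfordTateFamilies) (hP : PridhamPerfectLifts C)
    (hAlg : PerfectComplexAlgebraisesLifts C) (hL : UniformObjLiftAtCM (sigmaObjClass C)) :
    Theses.PadicSemiregularLift.HodgeAbelianVarieties :=
  hc_av_of_hc_cm_of_deligne1982_of_pridhamPerfect_of_algebraisesLifts_of_uniformGluableSigmaLift C hCM hD hP hAlg
    (hL.mono fun _ _ _ _ h ↦ perfectObjClass_gluable_of_sigma C h)

/-- **P-L2 — the perfect-complex door with `HC_CM` DISCHARGED**: André 1992 ∧ P₂ ∧ P₃ ∧ [Deligne 1982] ∧ PridhamPerfectLifts C ∧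
PerfectComplexAlgebraisesLifts C (KERNEL from versal charts, `perfectComplexAlgebraisesLifts_of_versalCharts`) ∧
UniformObjLiftAtCM (perfectObjClass C gluableSigmaAdmissible) ⟹ `HC_CM ∧ HC_AV`, `HC_CM` occurring zero times among the
hypotheses (ring 2's domination ∘ O-1 ∘ p7's transfer theorem). NOT a proof sketch: the lift is speculative, P₂/P₃ are open
leaves (P₃ printed for anchor-good CM fields only). [cite: Andre1992HodgeCM, Théorème]
[cite: Pridham2024Semiregularity, Cor. 2.25 and Rem. 2.27] [cite: Deligne1982HodgeCycles, Prop. 6.1] -/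
theorem hc_cm_and_hc_av_of_andre_of_anchors_of_deligne1982_of_pridhamPerfect_of_algebraisesLifts_of_uniformGluableSigmaLift
    (C : ChernCharacterBetti) (hA : Andre1992_hodgeClasses_cmAbelianVariety_mem_span_pullback_weilClasses)
    (hP₂ : DivisorGeneratedCMPointedWeilFamiliesQuadratic) (hP₃ : DivisorGeneratedCMPointedWeilFamiliesCMField)
    (hD : deligne1982_cmDenseMumfordTateFamilies) (hP : PridhamPerfectLifts C) (hAlg : PerfectComplexAlgebraisesLifts C)
    (hL : UniformObjLiftAtCM (perfectObjClass C gluableSigmaAdmissible)) :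
    Theses.RankFourFaces.CMAbelianHodge ∧ Theses.PadicSemiregularLift.HodgeAbelianVarieties :=
  have hT := localVariationalHodgeFor_gluable_of_pridhamPerfect_of_algebraisesLifts hP hAlg
  ⟨hc_cm_of_andre_of_anchors_of_localVariationalHodgeFor_of_uniformObjLift hA hP₂ hP₃ hT hL,
    hc_av_of_andre_of_anchors_of_deligne1982_of_localVariationalHodgeFor_of_uniformObjLift hA hP₂ hP₃ hD hT hL⟩

/-! ### §5 SANITY: seat G4's sheaf ∀-form is the instance `𝒪 = bfSheafClass C` (the abstraction loses nothing) -/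

/-- **S-0 — `UniformSemiregularSheafLiftAtCM C ⟹ UniformObjLiftAtCM (bfSheafClass C)`**: take the fibre itself as the model
(`e = Iso.refl _`, `(𝟙)^* = 𝟙` by `complexBetti.map_id`) and `κ_{i,q} := ch_q(E_i)`. [cite: BuchweitzFlenner2003, §5 (I-semiregular)] -/
theorem uniformObjLift_bfSheafClass_of_uniformSheafLift (C : ChernCharacterBetti) (hL : UniformSemiregularSheafLiftAtCM C) :
    UniformObjLiftAtCM (bfSheafClass C) := by
  intro S 𝒳 f m p G s₀ A₀ e₀ h𝒳 hS hsm hirr hf hA₀ hCM halg hG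
  obtain ⟨U, hs₀U, hUo, r, c, E, hE, Ideg, hpI, hsr, hsum, hHodge⟩ :=
    hL S 𝒳 f m p G s₀ A₀ e₀ h𝒳 hS hsm hirr hf hA₀ hCM halg hG
  refine ⟨U, hs₀U, hUo, fiberOver f s₀, Iso.refl _, r, c, Ideg, fun i q ↦ C.ch (fiberOver f s₀) (E i) q, hpI,
    fun i ↦ ⟨E i, hE i, hsr i, fun _ _ ↦ rfl⟩, ?_, ?_⟩
  · simpa only [Iso.refl_inv, complexBetti.map_id, CategoryTheory.id_apply] using hsum
  · intro hU i q hq t γ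
    simpa only [Iso.refl_inv, complexBetti.map_id, CategoryTheory.id_apply] using hHodge hU i q hq t γ

/-- **S-2′ — seat G4's 2026-08-22 end statement RE-DERIVED through the door-agnostic row**: `HC_CM ∧ [Deligne 1982] ∧
[Buchweitz–Flenner 2003 Thm. 5.1, MODEL rendering] ∧ UniformSemiregularSheafLiftAtCM C ⟹ HC_AV` (O-2′ at `𝒪 = bfSheafClass C`,
with p7's `localVariationalHodgeFor_bfSheafClass`; the model rendering implies the fixed-fibre rendering used on 2026-08-22,
`BuchweitzFlenner2003_variationalHodge_ISemiregular_of_model`). [cite: BuchweitzFlenner2003, §5 Thm. 5.1]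
[cite: Deligne1982HodgeCycles, Prop. 6.1] -/
theorem hc_av_of_hc_cm_of_deligne1982_of_BFmodel_of_uniformSheafLift (C : ChernCharacterBetti)
    (hCM : Theses.RankFourFaces.CMAbelianHodge) (hD : deligne1982_cmDenseMumfordTateFamilies)
    (hBF : BuchweitzFlenner2003_variationalHodge_ISemiregular_model) (hL : UniformSemiregularSheafLiftAtCM C) :
    Theses.PadicSemiregularLift.HodgeAbelianVarieties :=
  hc_av_of_hc_cm_of_deligne1982_of_localVariationalHodgeFor_of_uniformObjLift hCM hD
    (localVariationalHodgeFor_bfSheafClass hBF C) (uniformObjLift_bfSheafClass_of_uniformSheafLift C hL)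

end Summit.Ventures.HSemireg.GeneralStructure

end
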